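import Summits.BirchSwinnertonDyer.BirchSwinnertonDyer.Theorems.EisensteinPrimesBSDpOnCellCTelescopeK2DivIntOfModuleDiv
import HarnessLib

/-!
# Crux 4 `BSDpOnCellC` (stmt-BirchSwinnertonDyer-19034), line «telescope» — K2-M♭ FROM ITS THREE TYPED LEAVES, BY NAME:
# `branchFibreDiv_of_leaves : N1 → N2 → N3 → K2-M♭` (Theorems PORT of ideator bsd-idea-12 g34's sorry-free kernel of
# `Cruxes/BSDpOnCellC/Lines/telescopeK2leaves.lean` §K, l.404–495; LEAD cruxlead-19034 g2; `--supports`, helper; closes nothing)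

WHY A PORT: the telescope skeleton of record (v7) carries ONE research stub `stub_branchFibreDiv` = K2-M♭ (module-level two-variable
algebraic control at a residually reducible `p ‖ N` point; = hypothesis `hM` of `TelescopeK2DivIntOfModuleDiv.carrierDivInt_of_branchFibreDiv`,
p741770). Ideator g34 (card `Ideas/k2-classical.md` rev 2.0, critic idea-crit-14 PASS) cut K2-M♭ — ONE ∃-statement mixing a CONSTRUCTION
(which `ρ₂`?) with CONTROL THEOREMS (what the fibres of a given `ρ₂` do) — into three typed leaves in Galois currency plus a sorry-free
kernel, in a `Cruxes/…/Lines` workfile, which a skeleton cannot import. This file is that kernel as a TREE THEOREM with the three leaf texts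
as explicit binders (texts copied token for token from the tree workfile l.111–183 / l.207–288 / l.309–399; conclusion = K2-M♭ = l.412–485 =
p741770's `hM`), so that a v8 of the skeleton may REGISTER the leaves as stubs and compose in one line over landed theorems (D-0171: every
research node decomposed to typed leaves). Pure logic; no mathematics is added or claimed.

* `h1` = **N1 `stub_branchLattice`** (construction / typist leaf): ∃ `ρ₂` on a discrete `ℤ_p⟦X⟧`-module `A₂` (∃-bound instances as in K2-M♭)
  with the FIBRE DATA FD — (tor) `X`-power torsion, (cof₀)/(cof_k) divisibility by `X` and `X − x_k`, (unr) finite ramification, (fd₀) an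
  equivariant `ℤ_p`-semilinear quasi-isomorphism `A₂[X] → E[p^∞]|_{Γ_K}`, (rat_k) `ℤ_p ↠ 𝒪_k`, (fd_k) an equivariant quasi-isomorphism
  `A₂[X − x_k] → A_{g_k}†|_{Γ_K}` (Hida 1986 Thm. 2.1 / Greenberg–Stevens 1993 §2 / Wiles 1988 §2, shape only).
* `h2` = **N2 `stub_weightTwoControl`** (bench XL + purity): for EVERY `ρ₂` with FD, (fg) ∧ (reg₀) ∧ (div₀) of K2-M♭.
* `h3` = **N3 `stub_memberControl`** (bench L): for every `ρ₂` with FD and (fg), `∀ k`, (reg_k) ∧ (ctrl_k) of K2-M♭.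
* conclusion = K2-M♭ TOKEN FOR TOKEN; proof = g34's five lines (choose `ρ₂` by `h1`, feed `h2`, `h3`).

HONEST FRAMING: a re-packaging implication between binder-only statements; N1/N2/N3 are NOT proved here (they are the research / typist /
bench content of crux 4's road-R-β half); no summit statement, no stub, no crux is proved; BSD is proved for no curve; 0 cells / labels /
tiers move. THEOREMS ONLY (no definition, no named fact, no `sorry`, no instance, no notation). Credit: ideator bsd-idea-12 g34 (texts and
kernel); the LEAD only ports.

## References (shape only)
[cite: Hida1986b, Thm. 2.1] [cite: GreenbergStevens1993, §2] [cite: Wiles1988, §2] [cite: Greenberg2016Selmer, Prop. 4.1.1]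
[cite: Ochiai2006, Prop. 5.1] [cite: SkinnerUrban2014, §3.1.6, Cor. 3.2.9] [cite: CastellaGrossiLeeSkinner2022, Thm. C]
-/

set_option autoImplicit false
set_option linter.dupNamespace false

noncomputable section

open scoped Classical MatrixGroups ModularForm

open CongruenceSubgroup WeierstrassCurve NumberField IsDedekindDomain Field PowerSeries
  Literature.NumberTheory.EllipticCurves Literature.NumberTheory.EllipticCurves.GreenbergSelmer
  Literature.NumberTheory.EllipticCurves.ModularForms Literature.NumberTheory.QuadraticFields
  Literature.NumberTheory.EllipticCurves.Rank1Residual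
  Literature.NumberTheory.EllipticCurves.Rank1Residual.Typed
  Literature.NumberTheory.GaloisRepresentations Literature.NumberTheory.GaloisCohomology
  Summit.BirchSwinnertonDyer.Rank1Residual.X11b.AcSelmer
  Summit.BirchSwinnertonDyer.Rank1Residual.X11b.Halves
  Summit.BirchSwinnertonDyer.Rank1Residual.X11b
  Summit.BirchSwinnertonDyer.Rank1Residual Summit.BirchSwinnertonDyer.Rank1Residual.X1
  Summit.BirchSwinnertonDyer.Rank1Residual.X2

open Literature.NumberTheory.EllipticCurves.BigGaloisRep
open Literature.NumberTheory.EllipticCurves.Castella2018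

namespace Summit.BirchSwinnertonDyer.BirchSwinnertonDyer.Theorems.TelescopeK2ModuleDivOfLeaves

open Summit.BirchSwinnertonDyer.BirchSwinnertonDyer.Theorems

set_option maxHeartbeats 1600000 in
/-- **K2-M♭ from its leaves** `N1 → N2 → N3 → K2-M♭` (pure logic; ideator bsd-idea-12 g34's kernel `K2Leaves.branchFibreDiv_of_leaves`, ported):
choose the branch representation `ρ₂` with its fibre data by N1, obtain (fg)/(reg₀)/(div₀) from N2 and the member clauses from N3. The
conclusion is `stub_branchFibreDiv` of telescope v7 (= `hM` of `TelescopeK2DivIntOfModuleDiv.carrierDivInt_of_branchFibreDiv`) TOKEN FOR TOKEN. [folklore] -/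
theorem branchFibreDiv_of_leaves
    (h1 :
    ∀ (W : WeierstrassCurve ℚ) [W.IsElliptic] [W.IsGloballyMinimal] (p : ℕ) [Fact p.Prime],
    ∀ (N : ℕ) [NeZero N] (K : Type) [Field K] [NumberField K] (Dt : ModularParametrizationData W N)
      (H : HeegnerDatum N (NumberField.discr K)) (ιK : K →+* ℂ) (P : (W.baseChange K).toAffine.Point),
      CellC W p → W.conductorNorm ℤ = N →
      IsImaginaryQuadratic K → NumberField.discr K < -4 → SatisfiesHeegnerHypothesis N K →
      (W.quadraticTwist (NumberField.discr K : ℚ)).entireLFunction 1 ≠ 0 →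
      WeierstrassCurve.Affine.Point.map ιK.toRatAlgHom P = heegnerPointComplex Dt H →
      ¬ (p : ℤ) ∣ Dt.c → ¬ IsOfFinAddOrder P →
      Odd (NumberField.discr K) →
      ∀ (κ : ZpExtension K p), κ.IsAnticyclotomic →
        ∀ (γ : Field.absoluteGaloisGroup K) [Fact (κ.IsTopGenerator γ)]
          (𝔭 : HeightOneSpectrum (𝓞 K)), ((p : ℕ) : 𝓞 K) ∈ 𝔭.asIdeal →
          𝔭.asIdeal.ramificationIdx (𝓞 ℚ) = 1 → 𝔭.asIdeal.inertiaDeg (𝓞 ℚ) = 1 →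
          ∀ (𝔭bar : HeightOneSpectrum (𝓞 K)), ((p : ℕ) : 𝓞 K) ∈ 𝔭bar.asIdeal → 𝔭bar ≠ 𝔭 →
            ((Ideal.span {(p : ℤ)}).primesOver (𝓞 K)).ncard = 2 →
          ∀ (f : CuspForm (CongruenceSubgroup.Gamma0 N) 2), IsNewformOf W f →
            ∀ (ι' : PadicAlgCl p ≃+* ℂ),
              (∀ (w : InfinitePlace K) (k : 𝓞 K),
                k ∈ 𝔭.asIdeal ↔ ‖ι'.symm (w.embedding (k : K))‖ < 1) →
              ∀ (ΩK : ℂ) (Ωp : ℂ_[p]) (Q : PowerSeries 𝓞_ℂ_[p]), ΩK ≠ 0 → ‖Ωp‖ = 1 →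
                R1.IsBDPLFunctionInt p ι' 𝔭 κ γ f ΩK Ωp Q →
      ∀ (L : PowerSeries (PowerSeries (unrIntegers p))) (x : ℕ → ℤ_[p]) (D : ℕ → Skinner2016.HidaCongruentForm W p 1),
        (∀ k, ‖x k‖ < 1) ∧ Filter.Tendsto x Filter.atTop (nhds 0) ∧
        (∃ e : ℕ, PowerSeries.C ((p : 𝓞_ℂ_[p]) ^ e) * Q ∈
          Ideal.span {PowerSeries.map (R1.unrToCpInt p) (PowerSeries.map (PowerSeries.constantCoeff (R := unrIntegers p)) L)}) ∧
        (∀ k : ℕ, (∀ y : coeffField (D k).g, ι' ((D k).ι y) = (y : ℂ)) ∧ 2 * ((p : ℤ) - 1) ∣ (D k).k - 2 ∧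
          ∃ (ΩKg : ℂ) (Ωpg : ℂ_[p]) (Lg : UnrSeries p), ΩKg ≠ 0 ∧ ‖Ωpg‖ = 1 ∧
            IsBDPLFunctionWt ι' 𝔭 κ γ (D k).g ΩKg Ωpg Lg ∧
          ∃ Ψ : UnrSeries p,
            (∃ U : PowerSeries (PowerSeries (unrIntegers p)),
              PowerSeries.map (PowerSeries.C (R := unrIntegers p)) Ψ =
                L + PowerSeries.C (PowerSeries.X - PowerSeries.C (toUnr p (x k))) * U) ∧
            (∃ e : ℕ, PowerSeries.C ((p : 𝓞_ℂ_[p]) ^ e) * PowerSeries.map (R1.unrToCpInt p) Ψ ∈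
              Ideal.span {PowerSeries.map (R1.unrToCpInt p) Lg})) ∧
        (∃ A : ℕ → UnrSeries p, ∀ ℓ : ℕ, ℓ.Prime → ¬ ℓ ∣ N →
          (∃ U : UnrSeries p, A ℓ = PowerSeries.C (toUnr p ((W.frobeniusTrace ℓ : ℤ) : ℤ_[p])) + PowerSeries.X * U) ∧
          ∀ k : ℕ, ∃ (c : unrIntegers p) (U : UnrSeries p),
            A ℓ = PowerSeries.C c + (PowerSeries.X - PowerSeries.C (toUnr p (x k))) * U ∧
            ((c : ℂ_[p]) = algebraMap (PadicAlgCl p) ℂ_[p]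
              ((D k).ι ⟨(UpperHalfPlane.qExpansion 1 ⇑(D k).g).coeff ℓ, coeff_mem_coeffField (D k).g ℓ⟩))) →
      ∃ (_ : TopologicalSpace (PowerSeries ℤ_[p])) (A₂ : Type) (_ : AddCommGroup A₂)
        (_ : Module (PowerSeries ℤ_[p]) A₂) (_ : TopologicalSpace A₂) (_ : DiscreteTopology A₂)
        (ρ₂ : ContinuousRep (Field.absoluteGaloisGroup K) (PowerSeries ℤ_[p]) A₂)
        (_ : TopologicalSpace (PowerSeries (PowerSeries ℤ_[p])))
        (_ : ContinuousSMul (PowerSeries (PowerSeries ℤ_[p])) (BigRepModule (PowerSeries ℤ_[p]) p A₂))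
        (_ : Module (PowerSeries ℤ_[p]) (XBig κ ρ₂ 𝔭bar (∅ : Set (HeightOneSpectrum (𝓞 K)))))
        (_ : IsScalarTower (PowerSeries ℤ_[p]) (PowerSeries (PowerSeries ℤ_[p]))
          (XBig κ ρ₂ 𝔭bar (∅ : Set (HeightOneSpectrum (𝓞 K))))),
        ((∀ a : A₂, ∃ n : ℕ, (PowerSeries.X : PowerSeries ℤ_[p]) ^ n • a = 0) ∧
          (∀ a : A₂, ∃ b : A₂, (PowerSeries.X : PowerSeries ℤ_[p]) • b = a) ∧
          (∀ (k : ℕ) (a : A₂), ∃ b : A₂, (PowerSeries.X - PowerSeries.C (x k)) • b = a) ∧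
          (∃ S₀ : Set (HeightOneSpectrum (𝓞 K)), S₀.Finite ∧ GaloisRep.IsUnramifiedOutside S₀ ρ₂) ∧
          (∃ θ₀ : Submodule.torsionBy (PowerSeries ℤ_[p]) A₂ (PowerSeries.X : PowerSeries ℤ_[p]) →+
              PrimaryTorsion (W.baseChange K).geomPoints p,
            (∀ (c : ℤ_[p]) (a : Submodule.torsionBy (PowerSeries ℤ_[p]) A₂ (PowerSeries.X : PowerSeries ℤ_[p])),
                θ₀ (PowerSeries.C c • a) = c • θ₀ a) ∧
            (∀ (σ : Field.absoluteGaloisGroup K)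
                (a : Submodule.torsionBy (PowerSeries ℤ_[p]) A₂ (PowerSeries.X : PowerSeries ℤ_[p])),
                θ₀ (BigGaloisRep.torsionRep ρ₂ (PowerSeries.X : PowerSeries ℤ_[p]) σ a) =
                  (W.baseChange K).primaryTorsionGaloisRep p σ (θ₀ a)) ∧
            Finite θ₀.ker ∧ Finite (PrimaryTorsion (W.baseChange K).geomPoints p ⧸ θ₀.range)) ∧
          (∀ k : ℕ, Function.Surjective (algebraMap ℤ_[p] (padicCoeffIntegers (D k).ι)) ∧
            ∃ θ : Submodule.torsionBy (PowerSeries ℤ_[p]) A₂ (PowerSeries.X - PowerSeries.C (x k)) →+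
                Cofree (D k).Δ.selfDualRep (padicCoeffField (D k).ι),
              (∀ (c : ℤ_[p])
                  (a : Submodule.torsionBy (PowerSeries ℤ_[p]) A₂ (PowerSeries.X - PowerSeries.C (x k))),
                  θ (PowerSeries.C c • a) = algebraMap ℤ_[p] (padicCoeffIntegers (D k).ι) c • θ a) ∧
              (∀ (σ : Field.absoluteGaloisGroup K)
                  (a : Submodule.torsionBy (PowerSeries ℤ_[p]) A₂ (PowerSeries.X - PowerSeries.C (x k))),
                  θ (BigGaloisRep.torsionRep ρ₂ (PowerSeries.X - PowerSeries.C (x k)) σ a) =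
                    (D k).Δ.selfDualCofreeRepOver K σ (θ a)) ∧
              Finite θ.ker ∧ Finite (Cofree (D k).Δ.selfDualRep (padicCoeffField (D k).ι) ⧸ θ.range))))
    (h2 :
    ∀ (W : WeierstrassCurve ℚ) [W.IsElliptic] [W.IsGloballyMinimal] (p : ℕ) [Fact p.Prime],
    ∀ (N : ℕ) [NeZero N] (K : Type) [Field K] [NumberField K] (Dt : ModularParametrizationData W N)
      (H : HeegnerDatum N (NumberField.discr K)) (ιK : K →+* ℂ) (P : (W.baseChange K).toAffine.Point),
      CellC W p → W.conductorNorm ℤ = N →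
      IsImaginaryQuadratic K → NumberField.discr K < -4 → SatisfiesHeegnerHypothesis N K →
      (W.quadraticTwist (NumberField.discr K : ℚ)).entireLFunction 1 ≠ 0 →
      WeierstrassCurve.Affine.Point.map ιK.toRatAlgHom P = heegnerPointComplex Dt H →
      ¬ (p : ℤ) ∣ Dt.c → ¬ IsOfFinAddOrder P →
      Odd (NumberField.discr K) →
      ∀ (κ : ZpExtension K p), κ.IsAnticyclotomic →
        ∀ (γ : Field.absoluteGaloisGroup K) [Fact (κ.IsTopGenerator γ)]
          (𝔭 : HeightOneSpectrum (𝓞 K)), ((p : ℕ) : 𝓞 K) ∈ 𝔭.asIdeal →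
          𝔭.asIdeal.ramificationIdx (𝓞 ℚ) = 1 → 𝔭.asIdeal.inertiaDeg (𝓞 ℚ) = 1 →
          ∀ (𝔭bar : HeightOneSpectrum (𝓞 K)), ((p : ℕ) : 𝓞 K) ∈ 𝔭bar.asIdeal → 𝔭bar ≠ 𝔭 →
            ((Ideal.span {(p : ℤ)}).primesOver (𝓞 K)).ncard = 2 →
          ∀ (f : CuspForm (CongruenceSubgroup.Gamma0 N) 2), IsNewformOf W f →
            ∀ (ι' : PadicAlgCl p ≃+* ℂ),
              (∀ (w : InfinitePlace K) (k : 𝓞 K),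
                k ∈ 𝔭.asIdeal ↔ ‖ι'.symm (w.embedding (k : K))‖ < 1) →
              ∀ (ΩK : ℂ) (Ωp : ℂ_[p]) (Q : PowerSeries 𝓞_ℂ_[p]), ΩK ≠ 0 → ‖Ωp‖ = 1 →
                R1.IsBDPLFunctionInt p ι' 𝔭 κ γ f ΩK Ωp Q →
      ∀ (L : PowerSeries (PowerSeries (unrIntegers p))) (x : ℕ → ℤ_[p]) (D : ℕ → Skinner2016.HidaCongruentForm W p 1),
        (∀ k, ‖x k‖ < 1) ∧ Filter.Tendsto x Filter.atTop (nhds 0) ∧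
        (∃ e : ℕ, PowerSeries.C ((p : 𝓞_ℂ_[p]) ^ e) * Q ∈
          Ideal.span {PowerSeries.map (R1.unrToCpInt p) (PowerSeries.map (PowerSeries.constantCoeff (R := unrIntegers p)) L)}) ∧
        (∀ k : ℕ, (∀ y : coeffField (D k).g, ι' ((D k).ι y) = (y : ℂ)) ∧ 2 * ((p : ℤ) - 1) ∣ (D k).k - 2 ∧
          ∃ (ΩKg : ℂ) (Ωpg : ℂ_[p]) (Lg : UnrSeries p), ΩKg ≠ 0 ∧ ‖Ωpg‖ = 1 ∧
            IsBDPLFunctionWt ι' 𝔭 κ γ (D k).g ΩKg Ωpg Lg ∧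
          ∃ Ψ : UnrSeries p,
            (∃ U : PowerSeries (PowerSeries (unrIntegers p)),
              PowerSeries.map (PowerSeries.C (R := unrIntegers p)) Ψ =
                L + PowerSeries.C (PowerSeries.X - PowerSeries.C (toUnr p (x k))) * U) ∧
            (∃ e : ℕ, PowerSeries.C ((p : 𝓞_ℂ_[p]) ^ e) * PowerSeries.map (R1.unrToCpInt p) Ψ ∈
              Ideal.span {PowerSeries.map (R1.unrToCpInt p) Lg})) ∧
        (∃ A : ℕ → UnrSeries p, ∀ ℓ : ℕ, ℓ.Prime → ¬ ℓ ∣ N →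
          (∃ U : UnrSeries p, A ℓ = PowerSeries.C (toUnr p ((W.frobeniusTrace ℓ : ℤ) : ℤ_[p])) + PowerSeries.X * U) ∧
          ∀ k : ℕ, ∃ (c : unrIntegers p) (U : UnrSeries p),
            A ℓ = PowerSeries.C c + (PowerSeries.X - PowerSeries.C (toUnr p (x k))) * U ∧
            ((c : ℂ_[p]) = algebraMap (PadicAlgCl p) ℂ_[p]
              ((D k).ι ⟨(UpperHalfPlane.qExpansion 1 ⇑(D k).g).coeff ℓ, coeff_mem_coeffField (D k).g ℓ⟩))) →
      ∀ [TopologicalSpace (PowerSeries ℤ_[p])] (A₂ : Type) [AddCommGroup A₂]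
        [Module (PowerSeries ℤ_[p]) A₂] [TopologicalSpace A₂] [DiscreteTopology A₂]
        (ρ₂ : ContinuousRep (Field.absoluteGaloisGroup K) (PowerSeries ℤ_[p]) A₂)
        [TopologicalSpace (PowerSeries (PowerSeries ℤ_[p]))]
        [ContinuousSMul (PowerSeries (PowerSeries ℤ_[p])) (BigRepModule (PowerSeries ℤ_[p]) p A₂)]
        [Module (PowerSeries ℤ_[p]) (XBig κ ρ₂ 𝔭bar (∅ : Set (HeightOneSpectrum (𝓞 K))))]
        [IsScalarTower (PowerSeries ℤ_[p]) (PowerSeries (PowerSeries ℤ_[p]))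
          (XBig κ ρ₂ 𝔭bar (∅ : Set (HeightOneSpectrum (𝓞 K))))],
        ((∀ a : A₂, ∃ n : ℕ, (PowerSeries.X : PowerSeries ℤ_[p]) ^ n • a = 0) ∧
          (∀ a : A₂, ∃ b : A₂, (PowerSeries.X : PowerSeries ℤ_[p]) • b = a) ∧
          (∀ (k : ℕ) (a : A₂), ∃ b : A₂, (PowerSeries.X - PowerSeries.C (x k)) • b = a) ∧
          (∃ S₀ : Set (HeightOneSpectrum (𝓞 K)), S₀.Finite ∧ GaloisRep.IsUnramifiedOutside S₀ ρ₂) ∧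
          (∃ θ₀ : Submodule.torsionBy (PowerSeries ℤ_[p]) A₂ (PowerSeries.X : PowerSeries ℤ_[p]) →+
              PrimaryTorsion (W.baseChange K).geomPoints p,
            (∀ (c : ℤ_[p]) (a : Submodule.torsionBy (PowerSeries ℤ_[p]) A₂ (PowerSeries.X : PowerSeries ℤ_[p])),
                θ₀ (PowerSeries.C c • a) = c • θ₀ a) ∧
            (∀ (σ : Field.absoluteGaloisGroup K)
                (a : Submodule.torsionBy (PowerSeries ℤ_[p]) A₂ (PowerSeries.X : PowerSeries ℤ_[p])),
                θ₀ (BigGaloisRep.torsionRep ρ₂ (PowerSeries.X : PowerSeries ℤ_[p]) σ a) =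
                  (W.baseChange K).primaryTorsionGaloisRep p σ (θ₀ a)) ∧
            Finite θ₀.ker ∧ Finite (PrimaryTorsion (W.baseChange K).geomPoints p ⧸ θ₀.range)) ∧
          (∀ k : ℕ, Function.Surjective (algebraMap ℤ_[p] (padicCoeffIntegers (D k).ι)) ∧
            ∃ θ : Submodule.torsionBy (PowerSeries ℤ_[p]) A₂ (PowerSeries.X - PowerSeries.C (x k)) →+
                Cofree (D k).Δ.selfDualRep (padicCoeffField (D k).ι),
              (∀ (c : ℤ_[p])
                  (a : Submodule.torsionBy (PowerSeries ℤ_[p]) A₂ (PowerSeries.X - PowerSeries.C (x k))),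
                  θ (PowerSeries.C c • a) = algebraMap ℤ_[p] (padicCoeffIntegers (D k).ι) c • θ a) ∧
              (∀ (σ : Field.absoluteGaloisGroup K)
                  (a : Submodule.torsionBy (PowerSeries ℤ_[p]) A₂ (PowerSeries.X - PowerSeries.C (x k))),
                  θ (BigGaloisRep.torsionRep ρ₂ (PowerSeries.X - PowerSeries.C (x k)) σ a) =
                    (D k).Δ.selfDualCofreeRepOver K σ (θ a)) ∧
              Finite θ.ker ∧ Finite (Cofree (D k).Δ.selfDualRep (padicCoeffField (D k).ι) ⧸ θ.range))) →
        Module.Finite (PowerSeries (PowerSeries ℤ_[p])) (XBig κ ρ₂ 𝔭bar (∅ : Set (HeightOneSpectrum (𝓞 K)))) ∧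
        (∃ s : PowerSeries (PowerSeries ℤ_[p]),
          ¬ (PowerSeries.C (PowerSeries.X : PowerSeries ℤ_[p]) ∣ s) ∧
            ∀ m : XBig κ ρ₂ 𝔭bar (∅ : Set (HeightOneSpectrum (𝓞 K))), s • m = 0) ∧
        (∃ j : ℕ, Ideal.span {PowerSeries.C ((p : ℤ_[p]) ^ j)} *
            (Literature.NumberTheory.EllipticCurves.Module.charIdeal (PowerSeries (PowerSeries ℤ_[p]))
                (XBig κ ρ₂ 𝔭bar (∅ : Set (HeightOneSpectrum (𝓞 K))))).map
              (PowerSeries.map (PowerSeries.constantCoeff (R := ℤ_[p]))) ≤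
          XAc.charIdeal (W.baseChange K) p κ 𝔭bar ∅ γ))
    (h3 :
    ∀ (W : WeierstrassCurve ℚ) [W.IsElliptic] [W.IsGloballyMinimal] (p : ℕ) [Fact p.Prime],
    ∀ (N : ℕ) [NeZero N] (K : Type) [Field K] [NumberField K] (Dt : ModularParametrizationData W N)
      (H : HeegnerDatum N (NumberField.discr K)) (ιK : K →+* ℂ) (P : (W.baseChange K).toAffine.Point),
      CellC W p → W.conductorNorm ℤ = N →
      IsImaginaryQuadratic K → NumberField.discr K < -4 → SatisfiesHeegnerHypothesis N K →
      (W.quadraticTwist (NumberField.discr K : ℚ)).entireLFunction 1 ≠ 0 →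
      WeierstrassCurve.Affine.Point.map ιK.toRatAlgHom P = heegnerPointComplex Dt H →
      ¬ (p : ℤ) ∣ Dt.c → ¬ IsOfFinAddOrder P →
      Odd (NumberField.discr K) →
      ∀ (κ : ZpExtension K p), κ.IsAnticyclotomic →
        ∀ (γ : Field.absoluteGaloisGroup K) [Fact (κ.IsTopGenerator γ)]
          (𝔭 : HeightOneSpectrum (𝓞 K)), ((p : ℕ) : 𝓞 K) ∈ 𝔭.asIdeal →
          𝔭.asIdeal.ramificationIdx (𝓞 ℚ) = 1 → 𝔭.asIdeal.inertiaDeg (𝓞 ℚ) = 1 →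
          ∀ (𝔭bar : HeightOneSpectrum (𝓞 K)), ((p : ℕ) : 𝓞 K) ∈ 𝔭bar.asIdeal → 𝔭bar ≠ 𝔭 →
            ((Ideal.span {(p : ℤ)}).primesOver (𝓞 K)).ncard = 2 →
          ∀ (f : CuspForm (CongruenceSubgroup.Gamma0 N) 2), IsNewformOf W f →
            ∀ (ι' : PadicAlgCl p ≃+* ℂ),
              (∀ (w : InfinitePlace K) (k : 𝓞 K),
                k ∈ 𝔭.asIdeal ↔ ‖ι'.symm (w.embedding (k : K))‖ < 1) →
              ∀ (ΩK : ℂ) (Ωp : ℂ_[p]) (Q : PowerSeries 𝓞_ℂ_[p]), ΩK ≠ 0 → ‖Ωp‖ = 1 →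
                R1.IsBDPLFunctionInt p ι' 𝔭 κ γ f ΩK Ωp Q →
      ∀ (L : PowerSeries (PowerSeries (unrIntegers p))) (x : ℕ → ℤ_[p]) (D : ℕ → Skinner2016.HidaCongruentForm W p 1),
        (∀ k, ‖x k‖ < 1) ∧ Filter.Tendsto x Filter.atTop (nhds 0) ∧
        (∃ e : ℕ, PowerSeries.C ((p : 𝓞_ℂ_[p]) ^ e) * Q ∈
          Ideal.span {PowerSeries.map (R1.unrToCpInt p) (PowerSeries.map (PowerSeries.constantCoeff (R := unrIntegers p)) L)}) ∧
        (∀ k : ℕ, (∀ y : coeffField (D k).g, ι' ((D k).ι y) = (y : ℂ)) ∧ 2 * ((p : ℤ) - 1) ∣ (D k).k - 2 ∧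
          ∃ (ΩKg : ℂ) (Ωpg : ℂ_[p]) (Lg : UnrSeries p), ΩKg ≠ 0 ∧ ‖Ωpg‖ = 1 ∧
            IsBDPLFunctionWt ι' 𝔭 κ γ (D k).g ΩKg Ωpg Lg ∧
          ∃ Ψ : UnrSeries p,
            (∃ U : PowerSeries (PowerSeries (unrIntegers p)),
              PowerSeries.map (PowerSeries.C (R := unrIntegers p)) Ψ =
                L + PowerSeries.C (PowerSeries.X - PowerSeries.C (toUnr p (x k))) * U) ∧
            (∃ e : ℕ, PowerSeries.C ((p : 𝓞_ℂ_[p]) ^ e) * PowerSeries.map (R1.unrToCpInt p) Ψ ∈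
              Ideal.span {PowerSeries.map (R1.unrToCpInt p) Lg})) ∧
        (∃ A : ℕ → UnrSeries p, ∀ ℓ : ℕ, ℓ.Prime → ¬ ℓ ∣ N →
          (∃ U : UnrSeries p, A ℓ = PowerSeries.C (toUnr p ((W.frobeniusTrace ℓ : ℤ) : ℤ_[p])) + PowerSeries.X * U) ∧
          ∀ k : ℕ, ∃ (c : unrIntegers p) (U : UnrSeries p),
            A ℓ = PowerSeries.C c + (PowerSeries.X - PowerSeries.C (toUnr p (x k))) * U ∧
            ((c : ℂ_[p]) = algebraMap (PadicAlgCl p) ℂ_[p]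
              ((D k).ι ⟨(UpperHalfPlane.qExpansion 1 ⇑(D k).g).coeff ℓ, coeff_mem_coeffField (D k).g ℓ⟩))) →
      ∀ [TopologicalSpace (PowerSeries ℤ_[p])] (A₂ : Type) [AddCommGroup A₂]
        [Module (PowerSeries ℤ_[p]) A₂] [TopologicalSpace A₂] [DiscreteTopology A₂]
        (ρ₂ : ContinuousRep (Field.absoluteGaloisGroup K) (PowerSeries ℤ_[p]) A₂)
        [TopologicalSpace (PowerSeries (PowerSeries ℤ_[p]))]
        [ContinuousSMul (PowerSeries (PowerSeries ℤ_[p])) (BigRepModule (PowerSeries ℤ_[p]) p A₂)]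
        [Module (PowerSeries ℤ_[p]) (XBig κ ρ₂ 𝔭bar (∅ : Set (HeightOneSpectrum (𝓞 K))))]
        [IsScalarTower (PowerSeries ℤ_[p]) (PowerSeries (PowerSeries ℤ_[p]))
          (XBig κ ρ₂ 𝔭bar (∅ : Set (HeightOneSpectrum (𝓞 K))))],
        ((∀ a : A₂, ∃ n : ℕ, (PowerSeries.X : PowerSeries ℤ_[p]) ^ n • a = 0) ∧
          (∀ a : A₂, ∃ b : A₂, (PowerSeries.X : PowerSeries ℤ_[p]) • b = a) ∧
          (∀ (k : ℕ) (a : A₂), ∃ b : A₂, (PowerSeries.X - PowerSeries.C (x k)) • b = a) ∧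
          (∃ S₀ : Set (HeightOneSpectrum (𝓞 K)), S₀.Finite ∧ GaloisRep.IsUnramifiedOutside S₀ ρ₂) ∧
          (∃ θ₀ : Submodule.torsionBy (PowerSeries ℤ_[p]) A₂ (PowerSeries.X : PowerSeries ℤ_[p]) →+
              PrimaryTorsion (W.baseChange K).geomPoints p,
            (∀ (c : ℤ_[p]) (a : Submodule.torsionBy (PowerSeries ℤ_[p]) A₂ (PowerSeries.X : PowerSeries ℤ_[p])),
                θ₀ (PowerSeries.C c • a) = c • θ₀ a) ∧
            (∀ (σ : Field.absoluteGaloisGroup K)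
                (a : Submodule.torsionBy (PowerSeries ℤ_[p]) A₂ (PowerSeries.X : PowerSeries ℤ_[p])),
                θ₀ (BigGaloisRep.torsionRep ρ₂ (PowerSeries.X : PowerSeries ℤ_[p]) σ a) =
                  (W.baseChange K).primaryTorsionGaloisRep p σ (θ₀ a)) ∧
            Finite θ₀.ker ∧ Finite (PrimaryTorsion (W.baseChange K).geomPoints p ⧸ θ₀.range)) ∧
          (∀ k : ℕ, Function.Surjective (algebraMap ℤ_[p] (padicCoeffIntegers (D k).ι)) ∧
            ∃ θ : Submodule.torsionBy (PowerSeries ℤ_[p]) A₂ (PowerSeries.X - PowerSeries.C (x k)) →+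
                Cofree (D k).Δ.selfDualRep (padicCoeffField (D k).ι),
              (∀ (c : ℤ_[p])
                  (a : Submodule.torsionBy (PowerSeries ℤ_[p]) A₂ (PowerSeries.X - PowerSeries.C (x k))),
                  θ (PowerSeries.C c • a) = algebraMap ℤ_[p] (padicCoeffIntegers (D k).ι) c • θ a) ∧
              (∀ (σ : Field.absoluteGaloisGroup K)
                  (a : Submodule.torsionBy (PowerSeries ℤ_[p]) A₂ (PowerSeries.X - PowerSeries.C (x k))),
                  θ (BigGaloisRep.torsionRep ρ₂ (PowerSeries.X - PowerSeries.C (x k)) σ a) =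
                    (D k).Δ.selfDualCofreeRepOver K σ (θ a)) ∧
              Finite θ.ker ∧ Finite (Cofree (D k).Δ.selfDualRep (padicCoeffField (D k).ι) ⧸ θ.range))) →
        Module.Finite (PowerSeries (PowerSeries ℤ_[p])) (XBig κ ρ₂ 𝔭bar (∅ : Set (HeightOneSpectrum (𝓞 K)))) →
        ∀ k : ℕ,
          (∃ s : PowerSeries (PowerSeries ℤ_[p]),
            ¬ (PowerSeries.C (PowerSeries.X - PowerSeries.C (x k)) ∣ s) ∧
              ∀ m : XBig κ ρ₂ 𝔭bar (∅ : Set (HeightOneSpectrum (𝓞 K))), s • m = 0) ∧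
          ∀ (b : padicCoeffIntegers (D k).ι →+* 𝓞_ℂ_[p]),
            (∀ y, ((b y : 𝓞_ℂ_[p]) : ℂ_[p]) =
              algebraMap (PadicAlgCl p) ℂ_[p] (padicCoeffIntegers.toPadicAlgCl (D k).ι y)) →
          ∀ [TopologicalSpace (PowerSeries (padicCoeffIntegers (D k).ι))]
            [ContinuousSMul (PowerSeries (padicCoeffIntegers (D k).ι))
              (BigRepModule (padicCoeffIntegers (D k).ι) p (Cofree (D k).Δ.selfDualRep (padicCoeffField (D k).ι)))],
            ∃ j : ℕ, Ideal.span {PowerSeries.C ((p : 𝓞_ℂ_[p]) ^ j)} *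
                (XBig.charIdeal κ ((D k).Δ.selfDualCofreeRepOver K) 𝔭bar
                  (∅ : Set (HeightOneSpectrum (𝓞 K)))).map (PowerSeries.map b) ≤
              (Literature.NumberTheory.EllipticCurves.Module.charIdeal (PowerSeries ℤ_[p])
                  (QuotSMulTop (PowerSeries.C (PowerSeries.X - PowerSeries.C (x k)))
                    (XBig κ ρ₂ 𝔭bar (∅ : Set (HeightOneSpectrum (𝓞 K)))))).map
                (PowerSeries.map (R1.toCpInt p))) :
    ∀ (W : WeierstrassCurve ℚ) [W.IsElliptic] [W.IsGloballyMinimal] (p : ℕ) [Fact p.Prime],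
    ∀ (N : ℕ) [NeZero N] (K : Type) [Field K] [NumberField K] (Dt : ModularParametrizationData W N)
      (H : HeegnerDatum N (NumberField.discr K)) (ιK : K →+* ℂ) (P : (W.baseChange K).toAffine.Point),
      CellC W p → W.conductorNorm ℤ = N →
      IsImaginaryQuadratic K → NumberField.discr K < -4 → SatisfiesHeegnerHypothesis N K →
      (W.quadraticTwist (NumberField.discr K : ℚ)).entireLFunction 1 ≠ 0 →
      WeierstrassCurve.Affine.Point.map ιK.toRatAlgHom P = heegnerPointComplex Dt H →
      ¬ (p : ℤ) ∣ Dt.c → ¬ IsOfFinAddOrder P →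
      Odd (NumberField.discr K) →
      ∀ (κ : ZpExtension K p), κ.IsAnticyclotomic →
        ∀ (γ : Field.absoluteGaloisGroup K) [Fact (κ.IsTopGenerator γ)]
          (𝔭 : HeightOneSpectrum (𝓞 K)), ((p : ℕ) : 𝓞 K) ∈ 𝔭.asIdeal →
          𝔭.asIdeal.ramificationIdx (𝓞 ℚ) = 1 → 𝔭.asIdeal.inertiaDeg (𝓞 ℚ) = 1 →
          ∀ (𝔭bar : HeightOneSpectrum (𝓞 K)), ((p : ℕ) : 𝓞 K) ∈ 𝔭bar.asIdeal → 𝔭bar ≠ 𝔭 →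
            ((Ideal.span {(p : ℤ)}).primesOver (𝓞 K)).ncard = 2 →
          ∀ (f : CuspForm (CongruenceSubgroup.Gamma0 N) 2), IsNewformOf W f →
            ∀ (ι' : PadicAlgCl p ≃+* ℂ),
              (∀ (w : InfinitePlace K) (k : 𝓞 K),
                k ∈ 𝔭.asIdeal ↔ ‖ι'.symm (w.embedding (k : K))‖ < 1) →
              ∀ (ΩK : ℂ) (Ωp : ℂ_[p]) (Q : PowerSeries 𝓞_ℂ_[p]), ΩK ≠ 0 → ‖Ωp‖ = 1 →
                R1.IsBDPLFunctionInt p ι' 𝔭 κ γ f ΩK Ωp Q →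
      ∀ (L : PowerSeries (PowerSeries (unrIntegers p))) (x : ℕ → ℤ_[p]) (D : ℕ → Skinner2016.HidaCongruentForm W p 1),
        (∀ k, ‖x k‖ < 1) ∧ Filter.Tendsto x Filter.atTop (nhds 0) ∧
        (∃ e : ℕ, PowerSeries.C ((p : 𝓞_ℂ_[p]) ^ e) * Q ∈
          Ideal.span {PowerSeries.map (R1.unrToCpInt p) (PowerSeries.map (PowerSeries.constantCoeff (R := unrIntegers p)) L)}) ∧
        (∀ k : ℕ, (∀ y : coeffField (D k).g, ι' ((D k).ι y) = (y : ℂ)) ∧ 2 * ((p : ℤ) - 1) ∣ (D k).k - 2 ∧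
          ∃ (ΩKg : ℂ) (Ωpg : ℂ_[p]) (Lg : UnrSeries p), ΩKg ≠ 0 ∧ ‖Ωpg‖ = 1 ∧
            IsBDPLFunctionWt ι' 𝔭 κ γ (D k).g ΩKg Ωpg Lg ∧
          ∃ Ψ : UnrSeries p,
            (∃ U : PowerSeries (PowerSeries (unrIntegers p)),
              PowerSeries.map (PowerSeries.C (R := unrIntegers p)) Ψ =
                L + PowerSeries.C (PowerSeries.X - PowerSeries.C (toUnr p (x k))) * U) ∧
            (∃ e : ℕ, PowerSeries.C ((p : 𝓞_ℂ_[p]) ^ e) * PowerSeries.map (R1.unrToCpInt p) Ψ ∈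
              Ideal.span {PowerSeries.map (R1.unrToCpInt p) Lg})) ∧
        (∃ A : ℕ → UnrSeries p, ∀ ℓ : ℕ, ℓ.Prime → ¬ ℓ ∣ N →
          (∃ U : UnrSeries p, A ℓ = PowerSeries.C (toUnr p ((W.frobeniusTrace ℓ : ℤ) : ℤ_[p])) + PowerSeries.X * U) ∧
          ∀ k : ℕ, ∃ (c : unrIntegers p) (U : UnrSeries p),
            A ℓ = PowerSeries.C c + (PowerSeries.X - PowerSeries.C (toUnr p (x k))) * U ∧
            ((c : ℂ_[p]) = algebraMap (PadicAlgCl p) ℂ_[p]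
              ((D k).ι ⟨(UpperHalfPlane.qExpansion 1 ⇑(D k).g).coeff ℓ, coeff_mem_coeffField (D k).g ℓ⟩))) →
      ∃ (_ : TopologicalSpace (PowerSeries ℤ_[p])) (A₂ : Type) (_ : AddCommGroup A₂)
        (_ : Module (PowerSeries ℤ_[p]) A₂) (_ : TopologicalSpace A₂) (_ : DiscreteTopology A₂)
        (ρ₂ : ContinuousRep (Field.absoluteGaloisGroup K) (PowerSeries ℤ_[p]) A₂)
        (_ : TopologicalSpace (PowerSeries (PowerSeries ℤ_[p])))
        (_ : ContinuousSMul (PowerSeries (PowerSeries ℤ_[p])) (BigRepModule (PowerSeries ℤ_[p]) p A₂))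
        (_ : Module (PowerSeries ℤ_[p]) (XBig κ ρ₂ 𝔭bar (∅ : Set (HeightOneSpectrum (𝓞 K)))))
        (_ : IsScalarTower (PowerSeries ℤ_[p]) (PowerSeries (PowerSeries ℤ_[p]))
          (XBig κ ρ₂ 𝔭bar (∅ : Set (HeightOneSpectrum (𝓞 K))))),
        Module.Finite (PowerSeries (PowerSeries ℤ_[p])) (XBig κ ρ₂ 𝔭bar (∅ : Set (HeightOneSpectrum (𝓞 K)))) ∧
        (∃ s : PowerSeries (PowerSeries ℤ_[p]),
          ¬ (PowerSeries.C (PowerSeries.X : PowerSeries ℤ_[p]) ∣ s) ∧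
            ∀ m : XBig κ ρ₂ 𝔭bar (∅ : Set (HeightOneSpectrum (𝓞 K))), s • m = 0) ∧
        (∃ j : ℕ, Ideal.span {PowerSeries.C ((p : ℤ_[p]) ^ j)} *
            (Literature.NumberTheory.EllipticCurves.Module.charIdeal (PowerSeries (PowerSeries ℤ_[p]))
                (XBig κ ρ₂ 𝔭bar (∅ : Set (HeightOneSpectrum (𝓞 K))))).map
              (PowerSeries.map (PowerSeries.constantCoeff (R := ℤ_[p]))) ≤
          XAc.charIdeal (W.baseChange K) p κ 𝔭bar ∅ γ) ∧
        ∀ k : ℕ,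
          (∃ s : PowerSeries (PowerSeries ℤ_[p]),
            ¬ (PowerSeries.C (PowerSeries.X - PowerSeries.C (x k)) ∣ s) ∧
              ∀ m : XBig κ ρ₂ 𝔭bar (∅ : Set (HeightOneSpectrum (𝓞 K))), s • m = 0) ∧
          ∀ (b : padicCoeffIntegers (D k).ι →+* 𝓞_ℂ_[p]),
            (∀ y, ((b y : 𝓞_ℂ_[p]) : ℂ_[p]) =
              algebraMap (PadicAlgCl p) ℂ_[p] (padicCoeffIntegers.toPadicAlgCl (D k).ι y)) →
          ∀ [TopologicalSpace (PowerSeries (padicCoeffIntegers (D k).ι))]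
            [ContinuousSMul (PowerSeries (padicCoeffIntegers (D k).ι))
              (BigRepModule (padicCoeffIntegers (D k).ι) p (Cofree (D k).Δ.selfDualRep (padicCoeffField (D k).ι)))],
            ∃ j : ℕ, Ideal.span {PowerSeries.C ((p : 𝓞_ℂ_[p]) ^ j)} *
                (XBig.charIdeal κ ((D k).Δ.selfDualCofreeRepOver K) 𝔭bar
                  (∅ : Set (HeightOneSpectrum (𝓞 K)))).map (PowerSeries.map b) ≤
              (Literature.NumberTheory.EllipticCurves.Module.charIdeal (PowerSeries ℤ_[p])
                  (QuotSMulTop (PowerSeries.C (PowerSeries.X - PowerSeries.C (x k)))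
                    (XBig κ ρ₂ 𝔭bar (∅ : Set (HeightOneSpectrum (𝓞 K)))))).map
                (PowerSeries.map (R1.toCpInt p)) := by
  intro W iE iGM p ip N iN K iF iNF Dt H ιK P hCellC hN hIQ hdisc hHeeg hL1 hmap hc hPinf hOdd κ hac γ iγ 𝔭 h𝔭p h𝔭e h𝔭f
    𝔭bar h𝔭barp hne hsplit f hf ι' hι' ΩK Ωp Q hΩK hΩp hQ L x D hpack
  obtain ⟨tΛ, A₂, iAG, iMod, tA, dA, ρ₂, tB, iCS, iMX, iST, hFD⟩ :=
    h1 W p N K Dt H ιK P hCellC hN hIQ hdisc hHeeg hL1 hmap hc hPinf hOdd κ hac γ 𝔭 h𝔭p h𝔭e h𝔭f 𝔭bar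
      h𝔭barp hne hsplit f hf ι' hι' ΩK Ωp Q hΩK hΩp hQ L x D hpack
  have h2' := h2 W p N K Dt H ιK P hCellC hN hIQ hdisc hHeeg hL1 hmap hc hPinf hOdd κ hac γ 𝔭 h𝔭p h𝔭e h𝔭f 𝔭bar
      h𝔭barp hne hsplit f hf ι' hι' ΩK Ωp Q hΩK hΩp hQ L x D hpack A₂ ρ₂ hFD
  exact ⟨tΛ, A₂, iAG, iMod, tA, dA, ρ₂, tB, iCS, iMX, iST, h2'.1, h2'.2.1, h2'.2.2,
    h3 W p N K Dt H ιK P hCellC hN hIQ hdisc hHeeg hL1 hmap hc hPinf hOdd κ hac γ 𝔭 h𝔭p h𝔭e h𝔭f 𝔭bar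
      h𝔭barp hne hsplit f hf ι' hι' ΩK Ωp Q hΩK hΩp hQ L x D hpack A₂ ρ₂ hFD h2'.1⟩

end Summit.BirchSwinnertonDyer.BirchSwinnertonDyer.Theorems.TelescopeK2ModuleDivOfLeaves

end
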